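import Summits.QuantumFields.BalabanUV.Beta.D1BFx.AssemblyEndTotalS
import Summits.QuantumFields.BalabanUV.Beta.D1BFx.RestTotalOfWordsS
import Summits.QuantumFields.BalabanUV.Beta.D1BFx.RoadEndBFxTotalShell

/-!
# `BalabanUV.Beta.D1BFx.RoadEndBFxTotalShellS` — road «BF-x» for binder row D1, THE TOTAL-REST END IN SHELL CURRENCY OVER THE TWO-PROFILE RE-CUT TABLE,
# variant «ENDₛ» (END-ii-SPEC v1.1 §3 (b), chain link 4): leaf-03-g5's `RoadEndBFxTotalShell` (§1 END, §2 with d0∕d1 and the (α)-leaf from the two PRINTED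
# statements BY NAME, §3 fed per word) with the loop-weight tie RESCALED by a displayed family `s : ℕ → ℝ` and the rest words
# `restKS n a (gfrz n a b) (s n • gfrz n a b)`; `s ≡ 1` is the END of record, `s n = n⁻²` is «END-ii»

HONEST DEPENDENCY (page 1, mandatory): continuum YM on T⁴ ⇐ BetaPertH ∧ nine spine estimates (0/9 proved); BetaPertH ⇐ (D1) ∧ (D4) ∧
CAP+tail; G-an2-4 gates asym, D1 and NE2/3/4.  HONEST FRAMING (cell contract, verbatim): «discharging `BetaPertH` makes Bałaban's UV
stability UNCONDITIONAL — a real constructive-QFT result; it is NOT the continuum limit and NOT the Clay problem.»  THIS MODULE DISCHARGES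
NOTHING of the wall: [folklore] re-wiring BY NAME of `AssemblyEndTotalS.defect_le_at_totalS` over leaf-07-g4's SHELL wall (`ShellRoadEnd.d1Drift_of_strongRoad_shell`)
along `n = Lc^m` (`AssemblyEnd.hT_of_pointwise`), the corner word's bound (§0, the record's argument), then composition with `FrozenLegTails.far_rows_d0_d1_of_prop12`
(rows d0∕d1) and `GluonLegTails.hGa_of_prop12` ((α)-leaf), both CONDITIONAL on the two printed statements `B5.Prop12Printed`∕`B5.Kernel126_127Printed` taken BY
NAME as `h12`∕`h126` (nothing printed is proved; no `Prop` minted), and the per-word glue `RestTotalOfWordsS.hRestTot_of_hRestS`.  No `def`, nothing cited,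
0 sorry; 0 wall binders (hW ∕ hR-sockets ∕ hSX-socket ∕ D1Tel ∕ D1Rep = 0); NOT (K), NOT D1, NOT `BetaPertH`, NOT continuum, NOT Clay.

ABSOLUTE RULE (cell charter, verbatim): «No internally-minted statement may enter as a cited fact. Every hypothesis is either kernel-proved in
this package or a verbatim quotation of a PUBLISHED theorem with page reference. The manuscript(s) under audit are NOT citable for their own
disputed steps — they are the thing under adjudication; programme-internal (2001/route/tribunal) claims are never citable.»

WHY (owner ruling ρ-g11-9 «GHOST UNITS»; `HOME/b2b-balaban-beta-d1-p2/END-ii-SPEC.md` v1.1 §§1–3; binder GO R-D1-g31-2 (b)).  The END of record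
(`RoadEndBFxWired` ⟸ `RoadEndBFxTotalShellGroups` ⟸ THIS lane) ties the loop weights by `hω`, short of R-4(v) by `n⁴` against the typed ghost leg, and
reads the ghost graded words at `gfrz`; the consistent reading (ii) rescales the tie and reads them at `n⁻²·gfrz`.  Links 1–3 (`SplitInstanceS`,
`AssemblyEndRecutS`, `AssemblyEndTotalS`) typed this for a scalar `s` at one block size; THIS FILE is the `∀ n` shell END over them with `s : ℕ → ℝ` displayed.
DISPLAYED DEBT AFTER THIS FILE, BY NAME (unchanged from the record but for the tie and the table): bridge B1 (`hB1`); (K) `hK` + `hωs` + `hlam`; the five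
slot-table sockets; `hdiv`; `hrowgh`; the SHELL rows `h2s`∕`d2s` of `gfrz`; `hRestTot` (or `hRest` per word) on the two-profile words; (U); `h12`∕`h126`.

CONTENT.
* §0 [folklore] **`rest_corner_recutS`** — the corner word's constant is `0` (any second profile).
* §1 [folklore] **`d1Drift_BFx_total_shellS`**.  §2 **`d1Drift_BFx_total_shell_of_prop12S`**.  §3 **`d1Drift_BFx_total_shell_of_prop12_of_perWordS`**.
Unit `b2b-balaban-beta-d1-p2` (road owner, gen 12); `LEAVES-BFx.md` row A7-ENDₛ (chain link 4, «TOTAL-SHELL-S»); END-ii-SPEC v1.1 §3 (b).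
-/

noncomputable section

open Finset Filter Topology
open Literature.Probability.LatticeModels (annulus)
open scoped BigOperators
open Literature.MathematicalPhysics.QuantumFieldTheory.Balaban1983to89
open Literature.MathematicalPhysics.QuantumFieldTheory.Balaban1983to89.Beta
open OneStepResolventKernel (JetData)
open OneStepKernelFamily (TbalOf D1Drift)
open WindowIdentification (fullSum psum)
open B12Sec2to5 (l1)
open DyadicShell (Pt toReal supNorm)
open ExpKernelCalculus (Site MKer BiLoc shiftK)
open SquareTable (stK)
open GhostTable (gFree)
open SpinTable (bfKernel)
open BubbleTransfer (unitVec)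
open DressedMomentNormalisation (resSite)
open Summit.QuantumFields.BalabanUV.Beta.TameKernelCalculus (Spr)
open Summit.QuantumFields.BalabanUV.Beta.D1BFx.GluonLeg (Ga)
open Summit.QuantumFields.BalabanUV.Beta.D1BFx.ReducedKernel (TableR TOfRed)
open Summit.QuantumFields.BalabanUV.Beta.D1BFx.DressedTadpoleTable (tableRed)
open Summit.QuantumFields.BalabanUV.Beta.D1BFx.ReducedKernelSandwich (fineHess)
open Summit.QuantumFields.BalabanUV.Beta.D1BFx.FineStencilBFBalaban (SbfBal)
open Summit.QuantumFields.BalabanUV.Beta.D1BFx.SecondStencilBF (Wbf)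
open Summit.QuantumFields.BalabanUV.Beta.D1BFx.GhostKernelComplete (PghQ fineHessGhQ)
open Summit.QuantumFields.BalabanUV.Beta.D1BFx.FrozenCorner (negAt)
open Summit.QuantumFields.BalabanUV.Beta.D1BFx.FrozenLegProfile (gfrz gfrz_neg gfrz_negAt decay_gfrz abs_gfrz_sub_gFree_le abs_gfrz_diff_flat_le)
open Summit.QuantumFields.BalabanUV.Beta.D1BFx.SplitInstance (RestIdx restK)
open Summit.QuantumFields.BalabanUV.Beta.D1BFx.SplitRecut (restK' restK'_corner_eq)
open Summit.QuantumFields.BalabanUV.Beta.D1BFx.SplitInstanceS (restKS restKS_corner_eq)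
open Summit.QuantumFields.BalabanUV.Beta.D1BFx.CornerRest (rest_corner_bound)
open Summit.QuantumFields.BalabanUV.Beta.D1BFx.CornerSummable (summable_weight₂_bfKernel summable_weight₁_bfKernel)
open Summit.QuantumFields.BalabanUV.Beta.D1BFx.Assembly (sum_uniform_resSite)
open Summit.QuantumFields.BalabanUV.Beta.D1BFx.AssemblyEnd (hT_of_pointwise)
open Summit.QuantumFields.BalabanUV.Beta.D1BFx.RoadEndBFxRecut (cornerIdx rowConst gfrz₀ gfrz₀_eq rowConst_nonneg)
open Summit.QuantumFields.BalabanUV.Beta.D1BFx.AssemblyEndTotalS (defect_le_at_totalS)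
open Summit.QuantumFields.BalabanUV.Beta.D1BFx.ShellRoadEnd (d1Drift_of_strongRoad_shell)
open Summit.QuantumFields.BalabanUV.Beta.D1BFx.RestTotalOfWordsS (hRestTot_of_hRestS)
open Summit.QuantumFields.BalabanUV.Beta.D1BFx.FrozenLegTails (nOf MOf hn1 far_rows_d0_d1_of_prop12)
open Summit.QuantumFields.BalabanUV.Beta.D1BFx.GluonLegTails (hGa_of_prop12)
open Summit.QuantumFields.BalabanUV.Beta.D1BFx.RoadEndBFxRecutTails (tailConst tailConst_nonneg)
open VectorTailsLoc (fam kfam)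
namespace Summit.QuantumFields.BalabanUV.Beta.D1BFx.RoadEndBFxTotalShellS

/-! ## §0 The corner word of the two-profile table is the record's: its base-point average has full sum `0` -/

section Corner

variable (n : ℕ) [NeZero n] (a : ℝ) (cE cΛ cR cK cQ cE₂ cJ4 cΛ₂ cR₂ cQ₂ x₀ ωgl ωgh N : ℝ) (WE WJ WΛ WR WQ : TableR) {μ ν : Fin 4}

/-- [folklore] **THE CORNER WORD OF THE TWO-PROFILE RE-CUT TABLE HAS CONSTANT `0`** at the pinned normalisation `lam = n⁸`, the frozen profile `gfrz n a` and
ANY second (ghost) profile `g'`: it is the record's corner word (`SplitInstanceS.restKS_corner_eq`), bounded by `RoadEndBFxTotal.rest_corner_recut`'s argument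
(`CornerRest.rest_corner_bound` + `gfrz_negAt` + `CornerSummable` ⟸ `Spr (Ga n a)`). -/
theorem rest_corner_recutS (hμν : μ ≠ ν) (hGa : Spr (Ga n a)) (g' : Pt → Pt → ℝ) :
    |∑ b ∈ (univ : Finset (Fin 4 → Fin n)).image resSite, ((n : ℝ) ^ 4)⁻¹ *
        fullSum (fun w : Pt => restKS n a (gfrz n a b) (g' b) cE cΛ cR cK cQ cE₂ cJ4 cΛ₂ cR₂ cQ₂ x₀ WE WJ WΛ WR WQ ωgl ωgh ((n : ℝ) ^ 8) N μ ν b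
          cornerIdx w)| ≤ 0 := by
  rw [cornerIdx]
  simp only [restKS_corner_eq, restK'_corner_eq]
  have hn8 : ((n : ℝ) ^ 8)⁻¹ * (n : ℝ) ^ 8 = 1 := inv_mul_cancel₀ (pow_ne_zero 8 (Nat.cast_ne_zero.mpr (NeZero.ne n)))
  refine rest_corner_bound n a (gb := fun b => gfrz n a b) cE cΛ cR cK cQ cE₂ cJ4 cΛ₂ cR₂ cQ₂ x₀ WE WJ WΛ WR WQ ωgl ωgh ((n : ℝ) ^ 8) N hμν
    (fun b w => gfrz_negAt μ w) (fun b => ?_) (fun b => ?_) hn8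
  · obtain ⟨C, δ', hδ', hgb⟩ := decay_gfrz hGa b
    exact summable_weight₂_bfKernel hδ' hgb N μ ν μ ν
  · obtain ⟨C, δ', hδ', hgb⟩ := decay_gfrz hGa b
    exact summable_weight₁_bfKernel hδ' hgb N μ ν ν

end Corner

/-! ## §1 The total-rest END in shell currency, two-profile table, rescaled tie -/

variable {Lc : ℕ} [NeZero Lc] {a N : ℝ} {μ ν : Fin 4} {υ : Type*} [Fintype υ]
  {cE cVH cΛ cR cK cQ cE₂ cJ4 cΛ₂ cR₂ cQ₂ x₀ ωgl ωgh : ℕ → ℝ} {WE WJ WΛ WR WQ : ℕ → TableR} {CE CJ CΛ CRt CQ δW : ℕ → ℝ}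
  {Ru : υ → ℕ → ℝ} {CU : υ → ℝ} {CRtot : ℝ} {A : ℕ → ℝ} {D₂ δ U₁ : ℝ}

/-- [folklore] **ROAD BF-x, END TO END, TOTAL-REST FORM, FAR ROWS h2∕d2 IN SHELL-ℓ¹ CURRENCY, variant «ENDₛ»** — exactly leaf-03-g5's
`RoadEndBFxTotalShell.d1Drift_BFx_total_shell` with TWO edits: the loop-weight tie is the RESCALED `hωs : ω_gh n·(s n·cK n)² = −2·ω_gl n·cE n²`
(displayed scalar family `s : ℕ → ℝ`; `s ≡ 1` = the END of record, `s n = n⁻²` = END-ii), and `hRestTot` bounds the off-corner total of the TWO-PROFILE re-cut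
words `restKS n a (gfrz n a b) (fun v => s n * gfrz n a b v) …` (ghost tadpole ∕ ghost bubble words at the rescaled frozen profile); every other hypothesis
byte-identical (B1, (K), `Spr (Ga n a)`, sockets, `hdiv`, `hrowgh`, h2s∕d0∕d1∕d2s, (U)); composed through `ShellRoadEnd.d1Drift_of_strongRoad_shell` and
`AssemblyEndTotalS.defect_le_at_totalS`. -/
theorem d1Drift_BFx_total_shellS (Js : ℕ → JetData 3 Lc) (hμν : μ ≠ ν) (hN : N ≠ 0) (hL : 2 ≤ Lc) (hodd : Odd Lc) (ha : 0 < a) (c : ℕ → ℝ)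
    (hD₂ : 0 ≤ D₂) (hA : ∀ j, 0 ≤ A j) (hδ : 0 < δ)
    -- the frozen profile's far rows: h2s∕d2s in SHELL currency, d0∕d1 pointwise
    (h2s : ∀ n : ℕ, 2 ≤ n → ∀ [NeZero n], ∀ b ∈ (univ : Finset (Fin 4 → Fin n)).image resSite, ∀ r : ℕ, r + 1 ≤ n →
      ∑ v ∈ annulus 4 r (r + 1), |(gfrz n a b (v + unitVec ν + unitVec μ) - gFree (v + unitVec ν + unitVec μ)) -
          (gfrz n a b (v + unitVec ν) - gFree (v + unitVec ν)) - (gfrz n a b (v + unitVec μ) - gFree (v + unitVec μ)) +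
          (gfrz n a b v - gFree v)| ≤ D₂ / (n : ℝ))
    (d0 : ∀ n : ℕ, 2 ≤ n → ∀ [NeZero n], ∀ b ∈ (univ : Finset (Fin 4 → Fin n)).image resSite, ∀ v : Pt, v ≠ 0 →
      |gfrz n a b v| ≤ A 0 * Real.exp (-(δ / n) * supNorm v) / (supNorm v : ℝ) ^ 2)
    (d1 : ∀ n : ℕ, 2 ≤ n → ∀ [NeZero n], ∀ b ∈ (univ : Finset (Fin 4 → Fin n)).image resSite, ∀ v : Pt, v ≠ 0 → ∀ ρ : Fin 4,
      |gfrz n a b (v + unitVec ρ) - gfrz n a b v| ≤ A 1 * Real.exp (-(δ / n) * supNorm v) / (supNorm v : ℝ) ^ 3)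
    (d2s : ∀ n : ℕ, 2 ≤ n → ∀ [NeZero n], ∀ b ∈ (univ : Finset (Fin 4 → Fin n)).image resSite, ∀ r : ℕ, n ≤ r →
      ∑ v ∈ annulus 4 r (r + 1), |gfrz n a b (v + unitVec ν + unitVec μ) - gfrz n a b (v + unitVec ν) - gfrz n a b (v + unitVec μ) + gfrz n a b v| ≤
        A 2 * Real.exp (-(δ / n) * ((r : ℝ) + 1)) / ((r : ℝ) + 1))
    -- bridge B1
    (hB1 : ∀ m : ℕ, 1 ≤ m → |(∑ j ∈ range m, B12Beta.secondMoment (TbalOf Lc Js j) μ ν) - c (Lc ^ m)| ≤ U₁)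
    -- the (α)-leaf and slot (K) with the loop-weight ratio and the PINNED normalisation
    (hGa : ∀ n : ℕ, 2 ≤ n → ∀ [NeZero n], Spr (Ga n a))
    (hK : ∀ n : ℕ, 2 ≤ n → Odd n → ∀ [NeZero n], c n =
      ωgl n * B12Beta.secondMoment (TOfRed n a (SbfBal n a (cE n) (cVH n) (cΛ n) (cR n) (cK n) (cQ n))
        (tableRed n (Wbf (cE₂ n) (cJ4 n) (cΛ₂ n) (cR₂ n) (cQ₂ n) (WE n) (WJ n) (WΛ n) (WR n) (WQ n)))) μ ν
      + ωgh n * B12Beta.secondMoment (PghQ n a (x₀ n) (cK n) (cQ n)) μ ν + ∑ u, Ru u n)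
    (s : ℕ → ℝ) (hωs : ∀ n : ℕ, 2 ≤ n → ωgh n * (s n * cK n) ^ 2 = -2 * (ωgl n * cE n ^ 2))
    (hlam : ∀ n : ℕ, 2 ≤ n → ωgl n * cE n ^ 2 = 2 * N ^ 2 * (n : ℝ) ^ 8)
    -- slot-table sockets
    (hδW : ∀ n, 0 < δW n)
    (hE : ∀ n κ u l u', BiLoc (WE n κ u l u') u u' (CE n) (δW n)) (hJ : ∀ n κ u l u', BiLoc (WJ n κ u l u') u u' (CJ n) (δW n))
    (hΛ : ∀ n κ u l u', BiLoc (WΛ n κ u l u') u u' (CΛ n) (δW n)) (hR : ∀ n κ u l u', BiLoc (WR n κ u l u') u u' (CRt n) (δW n))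
    (hQ : ∀ n κ u l u', BiLoc (WQ n κ u l u') u u' (CQ n) (δW n))
    (hEc : ∀ (n : ℕ) (κ : Fin 4) (u : Site 4) (l : Fin 4) (u' t : Site 4),
      WE n κ (u + (n : ℤ) • t) l (u' + (n : ℤ) • t) = shiftK (-((n : ℤ) • t)) (WE n κ u l u'))
    (hJc : ∀ (n : ℕ) (κ : Fin 4) (u : Site 4) (l : Fin 4) (u' t : Site 4),
      WJ n κ (u + (n : ℤ) • t) l (u' + (n : ℤ) • t) = shiftK (-((n : ℤ) • t)) (WJ n κ u l u'))
    (hΛc : ∀ (n : ℕ) (κ : Fin 4) (u : Site 4) (l : Fin 4) (u' t : Site 4),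
      WΛ n κ (u + (n : ℤ) • t) l (u' + (n : ℤ) • t) = shiftK (-((n : ℤ) • t)) (WΛ n κ u l u'))
    (hRc : ∀ (n : ℕ) (κ : Fin 4) (u : Site 4) (l : Fin 4) (u' t : Site 4),
      WR n κ (u + (n : ℤ) • t) l (u' + (n : ℤ) • t) = shiftK (-((n : ℤ) • t)) (WR n κ u l u'))
    (hQc : ∀ (n : ℕ) (κ : Fin 4) (u : Site 4) (l : Fin 4) (u' t : Site 4),
      WQ n κ (u + (n : ℤ) • t) l (u' + (n : ℤ) • t) = shiftK (-((n : ℤ) • t)) (WQ n κ u l u'))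
    (hEs : ∀ n κ u l u', WE n κ u l u' = WE n l u' κ u) (hJs : ∀ n κ u l u', WJ n κ u l u' = WJ n l u' κ u)
    (hΛs : ∀ n κ u l u', WΛ n κ u l u' = WΛ n l u' κ u) (hRs : ∀ n κ u l u', WR n κ u l u' = WR n l u' κ u)
    (hQs : ∀ n κ u l u', WQ n κ u l u' = WQ n l u' κ u)
    -- first-bond divergence-freeness of the gluon fine Hessian kernel; the ghost Ward rows
    (hdiv : ∀ n : ℕ, 2 ≤ n → ∀ [NeZero n], ∀ (l' : Fin 4) (u' u : Site 4), ∑ κ' : Fin 4,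
      (fineHess n a (SbfBal n a (cE n) (cVH n) (cΛ n) (cR n) (cK n) (cQ n))
          (Wbf (cE₂ n) (cJ4 n) (cΛ₂ n) (cR₂ n) (cQ₂ n) (WE n) (WJ n) (WΛ n) (WR n) (WQ n)) κ' l' (u - Pi.single κ' 1) u'
        - fineHess n a (SbfBal n a (cE n) (cVH n) (cΛ n) (cR n) (cK n) (cQ n))
          (Wbf (cE₂ n) (cJ4 n) (cΛ₂ n) (cR₂ n) (cQ₂ n) (WE n) (WJ n) (WΛ n) (WR n) (WQ n)) κ' l' u u') = 0)
    (hrowgh : ∀ n : ℕ, 2 ≤ n → ∀ [NeZero n], ∀ (κ' l' : Fin 4) (b : Site 4), HasSum (fineHessGhQ n a (x₀ n) (cK n) (cQ n) κ' l' b) 0)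
    -- (REST-TOTAL): ONE n-UNIFORM bound on the base-point average of the full sum of THE SUM OF ALL NON-CORNER RE-CUT WORDS; (U)
    (hRestTot : ∀ n : ℕ, 2 ≤ n → ∀ [NeZero n],
      |∑ b ∈ (univ : Finset (Fin 4 → Fin n)).image resSite, ((n : ℝ) ^ 4)⁻¹ *
        fullSum (fun w : Pt => ∑ τ ∈ (univ : Finset RestIdx).erase cornerIdx,
          restKS n a (gfrz n a b) (fun v => s n * gfrz n a b v) (cE n) (cΛ n) (cR n) (cK n) (cQ n) (cE₂ n) (cJ4 n) (cΛ₂ n) (cR₂ n) (cQ₂ n) (x₀ n)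
            (WE n) (WJ n) (WΛ n) (WR n) (WQ n) (ωgl n) (ωgh n) ((n : ℝ) ^ 8) N μ ν b τ w)| ≤ CRtot)
    (hU : ∀ n : ℕ, 2 ≤ n → ∀ u, |Ru u n| ≤ CU u) :
    D1Drift Lc Js N μ ν := by
  refine d1Drift_of_strongRoad_shell Js hμν hN hL c (Bset := fun n => (univ : Finset (Fin 4 → Fin n)).image resSite)
    (wt := fun n _ => ((n : ℝ) ^ 4)⁻¹) (Gf := gfrz₀ a) (U₂ := (∑ u, CU u) + (0 + CRtot))
    (D := rowConst a D₂) (A := A) (δ := δ)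
    (rowConst_nonneg ha hD₂) hA hδ (fun n _ _ _ => by positivity) (fun n hn => sum_uniform_resSite (by omega)) ?_ ?_ ?_ ?_ ?_ ?_ hB1 ?_
  · intro n hn b _ v
    haveI : NeZero n := ⟨by omega⟩
    rw [gfrz₀_eq a n]
    exact abs_gfrz_sub_gFree_le n (le_trans one_le_two hn) ha b v
  · intro n hn b _ v ρ
    haveI : NeZero n := ⟨by omega⟩
    rw [gfrz₀_eq a n]
    exact abs_gfrz_diff_flat_le n (le_trans one_le_two hn) ha b v ρ
  · intro n hn b hb r hr
    haveI : NeZero n := ⟨by omega⟩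
    rw [gfrz₀_eq a n]
    exact h2s n hn b hb r hr
  · intro n hn b hb v hv
    haveI : NeZero n := ⟨by omega⟩
    rw [gfrz₀_eq a n]
    exact d0 n hn b hb v hv
  · intro n hn b hb v hv ρ
    haveI : NeZero n := ⟨by omega⟩
    rw [gfrz₀_eq a n]
    exact d1 n hn b hb v hv ρ
  · intro n hn b hb r hr
    haveI : NeZero n := ⟨by omega⟩
    rw [gfrz₀_eq a n]
    exact d2s n hn b hb r hr
  refine hT_of_pointwise (c := c)
    (F := fun n => ∑ b ∈ (univ : Finset (Fin 4 → Fin n)).image resSite, ((n : ℝ) ^ 4)⁻¹ * fullSum (stK μ ν N (gfrz₀ a n b)))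
    (U := (∑ u, CU u) + (0 + CRtot)) (fun n hn hon => ?_) hL hodd
  haveI : NeZero n := ⟨by omega⟩
  rw [gfrz₀_eq a n]
  exact defect_le_at_totalS n a (cE n) (cVH n) (cΛ n) (cR n) (cK n) (cQ n) (cE₂ n) (cJ4 n) (cΛ₂ n) (cR₂ n) (cQ₂ n) (x₀ n) (ωgl n) (ωgh n)
    ((n : ℝ) ^ 8) N (gp := gfrz n a) hn hon ha hμν (hGa n hn) (hK n hn hon) (s n) (hωs n hn) (hlam n hn) (hδW n) (hE n) (hJ n) (hΛ n) (hR n)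
    (hQ n) (hEc n) (hJc n) (hΛc n) (hRc n) (hQc n) (hEs n) (hJs n) (hΛs n) (hRs n) (hQs n) (hdiv n hn) (hrowgh n hn)
    (fun b => decay_gfrz (hGa n hn) b) (fun b w => gfrz_neg w)
    (rest_corner_recutS n a (cE n) (cΛ n) (cR n) (cK n) (cQ n) (cE₂ n) (cJ4 n) (cΛ₂ n) (cR₂ n) (cQ₂ n) (x₀ n) (ωgl n) (ωgh n) N
      (WE n) (WJ n) (WΛ n) (WR n) (WQ n) hμν (hGa n hn) (fun b v => s n * gfrz n a b v)) (hRestTot n hn) (hU n hn)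


/-! ## §2 The total-rest END with d0∕d1 and the (α)-leaf from the printed statements -/

/-- [folklore] **ROAD BF-x, THE DEBT END (total-rest form, shell currency), variant «ENDₛ», WITH d0∕d1 AND `Spr (Ga n a)` FROM [B5, Prop. 1.2] ∧
[B5, (1.126)–(1.127)] BY NAME.**  `d1Drift_BFx_total_shellS` with the rows d0∕d1 supplied by `FrozenLegTails.far_rows_d0_d1_of_prop12` and `hGa` by `GluonLegTails.hGa_of_prop12`
from the two printed statements `h12`∕`h126` (hypotheses, NOT proved here); the shell rows `h2s` (`D₂ ≥ 0`) and `d2s` (rate `δ₂ > 0`, constant `A₂ ≥ 0`),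
B1, (K) with `hωs`, the sockets, `hdiv`, `hrowgh`, `hRestTot` (two-profile words) and (U) remain displayed verbatim. -/
theorem d1Drift_BFx_total_shell_of_prop12S (Js : ℕ → JetData 3 Lc) (hμν : μ ≠ ν) (hN : N ≠ 0) (hL : 2 ≤ Lc) (hodd : Odd Lc) (ha : 0 < a)
    (c : ℕ → ℝ) {A₂ δ₂ : ℝ} (hD₂ : 0 ≤ D₂) (hA₂ : 0 ≤ A₂) (hδ₂ : 0 < δ₂)
    -- the two PRINTED statements, by name, for the family scale × even cubic volumes
    (h12 : B5.Prop12Printed (fam nOf hn1 MOf a ha)) (h126 : B5.Kernel126_127Printed (kfam nOf MOf))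
    -- the frozen profile's same-leg second differences, SHELL currency
    (h2s : ∀ n : ℕ, 2 ≤ n → ∀ [NeZero n], ∀ b ∈ (univ : Finset (Fin 4 → Fin n)).image resSite, ∀ r : ℕ, r + 1 ≤ n →
      ∑ v ∈ annulus 4 r (r + 1), |(gfrz n a b (v + unitVec ν + unitVec μ) - gFree (v + unitVec ν + unitVec μ)) -
          (gfrz n a b (v + unitVec ν) - gFree (v + unitVec ν)) - (gfrz n a b (v + unitVec μ) - gFree (v + unitVec μ)) +
          (gfrz n a b v - gFree v)| ≤ D₂ / (n : ℝ))
    (d2s : ∀ n : ℕ, 2 ≤ n → ∀ [NeZero n], ∀ b ∈ (univ : Finset (Fin 4 → Fin n)).image resSite, ∀ r : ℕ, n ≤ r →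
      ∑ v ∈ annulus 4 r (r + 1), |gfrz n a b (v + unitVec ν + unitVec μ) - gfrz n a b (v + unitVec ν) - gfrz n a b (v + unitVec μ) + gfrz n a b v| ≤
        A₂ * Real.exp (-(δ₂ / n) * ((r : ℝ) + 1)) / ((r : ℝ) + 1))
    -- bridge B1
    (hB1 : ∀ m : ℕ, 1 ≤ m → |(∑ j ∈ range m, B12Beta.secondMoment (TbalOf Lc Js j) μ ν) - c (Lc ^ m)| ≤ U₁)
    -- slot (K) with the loop-weight ratio and the PINNED normalisation
    (hK : ∀ n : ℕ, 2 ≤ n → Odd n → ∀ [NeZero n], c n =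
      ωgl n * B12Beta.secondMoment (TOfRed n a (SbfBal n a (cE n) (cVH n) (cΛ n) (cR n) (cK n) (cQ n))
        (tableRed n (Wbf (cE₂ n) (cJ4 n) (cΛ₂ n) (cR₂ n) (cQ₂ n) (WE n) (WJ n) (WΛ n) (WR n) (WQ n)))) μ ν
      + ωgh n * B12Beta.secondMoment (PghQ n a (x₀ n) (cK n) (cQ n)) μ ν + ∑ u, Ru u n)
    (s : ℕ → ℝ) (hωs : ∀ n : ℕ, 2 ≤ n → ωgh n * (s n * cK n) ^ 2 = -2 * (ωgl n * cE n ^ 2))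
    (hlam : ∀ n : ℕ, 2 ≤ n → ωgl n * cE n ^ 2 = 2 * N ^ 2 * (n : ℝ) ^ 8)
    -- slot-table sockets
    (hδW : ∀ n, 0 < δW n)
    (hE : ∀ n κ u l u', BiLoc (WE n κ u l u') u u' (CE n) (δW n)) (hJ : ∀ n κ u l u', BiLoc (WJ n κ u l u') u u' (CJ n) (δW n))
    (hΛ : ∀ n κ u l u', BiLoc (WΛ n κ u l u') u u' (CΛ n) (δW n)) (hR : ∀ n κ u l u', BiLoc (WR n κ u l u') u u' (CRt n) (δW n))
    (hQ : ∀ n κ u l u', BiLoc (WQ n κ u l u') u u' (CQ n) (δW n))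
    (hEc : ∀ (n : ℕ) (κ : Fin 4) (u : Site 4) (l : Fin 4) (u' t : Site 4),
      WE n κ (u + (n : ℤ) • t) l (u' + (n : ℤ) • t) = shiftK (-((n : ℤ) • t)) (WE n κ u l u'))
    (hJc : ∀ (n : ℕ) (κ : Fin 4) (u : Site 4) (l : Fin 4) (u' t : Site 4),
      WJ n κ (u + (n : ℤ) • t) l (u' + (n : ℤ) • t) = shiftK (-((n : ℤ) • t)) (WJ n κ u l u'))
    (hΛc : ∀ (n : ℕ) (κ : Fin 4) (u : Site 4) (l : Fin 4) (u' t : Site 4),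
      WΛ n κ (u + (n : ℤ) • t) l (u' + (n : ℤ) • t) = shiftK (-((n : ℤ) • t)) (WΛ n κ u l u'))
    (hRc : ∀ (n : ℕ) (κ : Fin 4) (u : Site 4) (l : Fin 4) (u' t : Site 4),
      WR n κ (u + (n : ℤ) • t) l (u' + (n : ℤ) • t) = shiftK (-((n : ℤ) • t)) (WR n κ u l u'))
    (hQc : ∀ (n : ℕ) (κ : Fin 4) (u : Site 4) (l : Fin 4) (u' t : Site 4),
      WQ n κ (u + (n : ℤ) • t) l (u' + (n : ℤ) • t) = shiftK (-((n : ℤ) • t)) (WQ n κ u l u'))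
    (hEs : ∀ n κ u l u', WE n κ u l u' = WE n l u' κ u) (hJs : ∀ n κ u l u', WJ n κ u l u' = WJ n l u' κ u)
    (hΛs : ∀ n κ u l u', WΛ n κ u l u' = WΛ n l u' κ u) (hRs : ∀ n κ u l u', WR n κ u l u' = WR n l u' κ u)
    (hQs : ∀ n κ u l u', WQ n κ u l u' = WQ n l u' κ u)
    -- first-bond divergence-freeness of the gluon fine Hessian kernel; the ghost Ward rows
    (hdiv : ∀ n : ℕ, 2 ≤ n → ∀ [NeZero n], ∀ (l' : Fin 4) (u' u : Site 4), ∑ κ' : Fin 4,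
      (fineHess n a (SbfBal n a (cE n) (cVH n) (cΛ n) (cR n) (cK n) (cQ n))
          (Wbf (cE₂ n) (cJ4 n) (cΛ₂ n) (cR₂ n) (cQ₂ n) (WE n) (WJ n) (WΛ n) (WR n) (WQ n)) κ' l' (u - Pi.single κ' 1) u'
        - fineHess n a (SbfBal n a (cE n) (cVH n) (cΛ n) (cR n) (cK n) (cQ n))
          (Wbf (cE₂ n) (cJ4 n) (cΛ₂ n) (cR₂ n) (cQ₂ n) (WE n) (WJ n) (WΛ n) (WR n) (WQ n)) κ' l' u u') = 0)
    (hrowgh : ∀ n : ℕ, 2 ≤ n → ∀ [NeZero n], ∀ (κ' l' : Fin 4) (b : Site 4), HasSum (fineHessGhQ n a (x₀ n) (cK n) (cQ n) κ' l' b) 0)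
    -- (REST-TOTAL); (U)
    (hRestTot : ∀ n : ℕ, 2 ≤ n → ∀ [NeZero n],
      |∑ b ∈ (univ : Finset (Fin 4 → Fin n)).image resSite, ((n : ℝ) ^ 4)⁻¹ *
        fullSum (fun w : Pt => ∑ τ ∈ (univ : Finset RestIdx).erase cornerIdx,
          restKS n a (gfrz n a b) (fun v => s n * gfrz n a b v) (cE n) (cΛ n) (cR n) (cK n) (cQ n) (cE₂ n) (cJ4 n) (cΛ₂ n) (cR₂ n) (cQ₂ n) (x₀ n)
            (WE n) (WJ n) (WΛ n) (WR n) (WQ n) (ωgl n) (ωgh n) ((n : ℝ) ^ 8) N μ ν b τ w)| ≤ CRtot)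
    (hU : ∀ n : ℕ, 2 ≤ n → ∀ u, |Ru u n| ≤ CU u) :
    D1Drift Lc Js N μ ν := by
  obtain ⟨δ₁, A₀, A₁, hδ₁, hA₀, hA₁, hd0, hd1⟩ := far_rows_d0_d1_of_prop12 ha h12 h126
  have hδ : 0 < min δ₁ δ₂ := lt_min hδ₁ hδ₂
  refine d1Drift_BFx_total_shellS (A := tailConst A₀ A₁ A₂) (δ := min δ₁ δ₂) Js hμν hN hL hodd ha c hD₂ (tailConst_nonneg hA₀ hA₁ hA₂) hδ h2s
    ?_ ?_ ?_ hB1 (hGa_of_prop12 ha h12 h126) hK s hωs hlam hδW hE hJ hΛ hR hQ hEc hJc hΛc hRc hQc hEs hJs hΛs hRs hQs hdiv hrowgh hRestTot hU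
  · intro n hn _ b hb v hv
    refine (hd0 n hn b hb v hv).trans ?_
    show A₀ * Real.exp (-(δ₁ / n) * supNorm v) / (supNorm v : ℝ) ^ 2 ≤ A₀ * Real.exp (-(min δ₁ δ₂ / n) * supNorm v) / (supNorm v : ℝ) ^ 2
    gcongr
    exact min_le_left _ _
  · intro n hn _ b hb v hv ρ
    refine (hd1 n hn b hb v hv ρ).trans ?_
    show A₁ * Real.exp (-(δ₁ / n) * supNorm v) / (supNorm v : ℝ) ^ 3 ≤ A₁ * Real.exp (-(min δ₁ δ₂ / n) * supNorm v) / (supNorm v : ℝ) ^ 3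
    gcongr
    exact min_le_left _ _
  · intro n hn _ b hb r hr
    refine (d2s n hn b hb r hr).trans ?_
    show A₂ * Real.exp (-(δ₂ / n) * ((r : ℝ) + 1)) / ((r : ℝ) + 1) ≤
      A₂ * Real.exp (-(min δ₁ δ₂ / n) * ((r : ℝ) + 1)) / ((r : ℝ) + 1)
    gcongr
    exact min_le_right _ _

/-! ## §3 The same END fed by a per-word (REST′) family -/

/-- [folklore] **THE «ENDₛ» DEBT END FED BY PER-WORD REST BOUNDS**: `d1Drift_BFx_total_shell_of_prop12S` with `hRestTot` supplied by the owner's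
`RestTotalOfWordsS.hRestTot_of_hRestS` from a per-word family `hRest` on the two-profile words (`∀ τ ≠ cornerIdx`, n-uniform constants `CR τ`), `CRtot := Σ_{τ ≠ cornerIdx} CR τ`;
the glue's (α)-leaf input is `GluonLegTails.hGa_of_prop12`.  Displayed: B1, (K), sockets, `hdiv`, `hrowgh`, shell rows h2s∕d2s, `hRest` per word, (U),
`h12`∕`h126`. -/
theorem d1Drift_BFx_total_shell_of_prop12_of_perWordS (Js : ℕ → JetData 3 Lc) (hμν : μ ≠ ν) (hN : N ≠ 0) (hL : 2 ≤ Lc) (hodd : Odd Lc)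
    (ha : 0 < a) (c : ℕ → ℝ) {A₂ δ₂ : ℝ} {CR : RestIdx → ℝ} (hD₂ : 0 ≤ D₂) (hA₂ : 0 ≤ A₂) (hδ₂ : 0 < δ₂)
    (h12 : B5.Prop12Printed (fam nOf hn1 MOf a ha)) (h126 : B5.Kernel126_127Printed (kfam nOf MOf))
    (h2s : ∀ n : ℕ, 2 ≤ n → ∀ [NeZero n], ∀ b ∈ (univ : Finset (Fin 4 → Fin n)).image resSite, ∀ r : ℕ, r + 1 ≤ n →
      ∑ v ∈ annulus 4 r (r + 1), |(gfrz n a b (v + unitVec ν + unitVec μ) - gFree (v + unitVec ν + unitVec μ)) -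
          (gfrz n a b (v + unitVec ν) - gFree (v + unitVec ν)) - (gfrz n a b (v + unitVec μ) - gFree (v + unitVec μ)) +
          (gfrz n a b v - gFree v)| ≤ D₂ / (n : ℝ))
    (d2s : ∀ n : ℕ, 2 ≤ n → ∀ [NeZero n], ∀ b ∈ (univ : Finset (Fin 4 → Fin n)).image resSite, ∀ r : ℕ, n ≤ r →
      ∑ v ∈ annulus 4 r (r + 1), |gfrz n a b (v + unitVec ν + unitVec μ) - gfrz n a b (v + unitVec ν) - gfrz n a b (v + unitVec μ) + gfrz n a b v| ≤
        A₂ * Real.exp (-(δ₂ / n) * ((r : ℝ) + 1)) / ((r : ℝ) + 1))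
    (hB1 : ∀ m : ℕ, 1 ≤ m → |(∑ j ∈ range m, B12Beta.secondMoment (TbalOf Lc Js j) μ ν) - c (Lc ^ m)| ≤ U₁)
    (hK : ∀ n : ℕ, 2 ≤ n → Odd n → ∀ [NeZero n], c n =
      ωgl n * B12Beta.secondMoment (TOfRed n a (SbfBal n a (cE n) (cVH n) (cΛ n) (cR n) (cK n) (cQ n))
        (tableRed n (Wbf (cE₂ n) (cJ4 n) (cΛ₂ n) (cR₂ n) (cQ₂ n) (WE n) (WJ n) (WΛ n) (WR n) (WQ n)))) μ ν
      + ωgh n * B12Beta.secondMoment (PghQ n a (x₀ n) (cK n) (cQ n)) μ ν + ∑ u, Ru u n)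
    (s : ℕ → ℝ) (hωs : ∀ n : ℕ, 2 ≤ n → ωgh n * (s n * cK n) ^ 2 = -2 * (ωgl n * cE n ^ 2))
    (hlam : ∀ n : ℕ, 2 ≤ n → ωgl n * cE n ^ 2 = 2 * N ^ 2 * (n : ℝ) ^ 8)
    (hδW : ∀ n, 0 < δW n)
    (hE : ∀ n κ u l u', BiLoc (WE n κ u l u') u u' (CE n) (δW n)) (hJ : ∀ n κ u l u', BiLoc (WJ n κ u l u') u u' (CJ n) (δW n))
    (hΛ : ∀ n κ u l u', BiLoc (WΛ n κ u l u') u u' (CΛ n) (δW n)) (hR : ∀ n κ u l u', BiLoc (WR n κ u l u') u u' (CRt n) (δW n))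
    (hQ : ∀ n κ u l u', BiLoc (WQ n κ u l u') u u' (CQ n) (δW n))
    (hEc : ∀ (n : ℕ) (κ : Fin 4) (u : Site 4) (l : Fin 4) (u' t : Site 4),
      WE n κ (u + (n : ℤ) • t) l (u' + (n : ℤ) • t) = shiftK (-((n : ℤ) • t)) (WE n κ u l u'))
    (hJc : ∀ (n : ℕ) (κ : Fin 4) (u : Site 4) (l : Fin 4) (u' t : Site 4),
      WJ n κ (u + (n : ℤ) • t) l (u' + (n : ℤ) • t) = shiftK (-((n : ℤ) • t)) (WJ n κ u l u'))
    (hΛc : ∀ (n : ℕ) (κ : Fin 4) (u : Site 4) (l : Fin 4) (u' t : Site 4),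
      WΛ n κ (u + (n : ℤ) • t) l (u' + (n : ℤ) • t) = shiftK (-((n : ℤ) • t)) (WΛ n κ u l u'))
    (hRc : ∀ (n : ℕ) (κ : Fin 4) (u : Site 4) (l : Fin 4) (u' t : Site 4),
      WR n κ (u + (n : ℤ) • t) l (u' + (n : ℤ) • t) = shiftK (-((n : ℤ) • t)) (WR n κ u l u'))
    (hQc : ∀ (n : ℕ) (κ : Fin 4) (u : Site 4) (l : Fin 4) (u' t : Site 4),
      WQ n κ (u + (n : ℤ) • t) l (u' + (n : ℤ) • t) = shiftK (-((n : ℤ) • t)) (WQ n κ u l u'))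
    (hEs : ∀ n κ u l u', WE n κ u l u' = WE n l u' κ u) (hJs : ∀ n κ u l u', WJ n κ u l u' = WJ n l u' κ u)
    (hΛs : ∀ n κ u l u', WΛ n κ u l u' = WΛ n l u' κ u) (hRs : ∀ n κ u l u', WR n κ u l u' = WR n l u' κ u)
    (hQs : ∀ n κ u l u', WQ n κ u l u' = WQ n l u' κ u)
    (hdiv : ∀ n : ℕ, 2 ≤ n → ∀ [NeZero n], ∀ (l' : Fin 4) (u' u : Site 4), ∑ κ' : Fin 4,
      (fineHess n a (SbfBal n a (cE n) (cVH n) (cΛ n) (cR n) (cK n) (cQ n))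
          (Wbf (cE₂ n) (cJ4 n) (cΛ₂ n) (cR₂ n) (cQ₂ n) (WE n) (WJ n) (WΛ n) (WR n) (WQ n)) κ' l' (u - Pi.single κ' 1) u'
        - fineHess n a (SbfBal n a (cE n) (cVH n) (cΛ n) (cR n) (cK n) (cQ n))
          (Wbf (cE₂ n) (cJ4 n) (cΛ₂ n) (cR₂ n) (cQ₂ n) (WE n) (WJ n) (WΛ n) (WR n) (WQ n)) κ' l' u u') = 0)
    (hrowgh : ∀ n : ℕ, 2 ≤ n → ∀ [NeZero n], ∀ (κ' l' : Fin 4) (b : Site 4), HasSum (fineHessGhQ n a (x₀ n) (cK n) (cQ n) κ' l' b) 0)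
    -- (REST′) PER WORD, n-UNIFORM, off the corner; (U)
    (hRest : ∀ n : ℕ, 2 ≤ n → ∀ [NeZero n], ∀ τ : RestIdx, τ ≠ cornerIdx →
      |∑ b ∈ (univ : Finset (Fin 4 → Fin n)).image resSite, ((n : ℝ) ^ 4)⁻¹ *
        fullSum (fun w : Pt => restKS n a (gfrz n a b) (fun v => s n * gfrz n a b v) (cE n) (cΛ n) (cR n) (cK n) (cQ n) (cE₂ n) (cJ4 n) (cΛ₂ n) (cR₂ n) (cQ₂ n) (x₀ n)
          (WE n) (WJ n) (WΛ n) (WR n) (WQ n) (ωgl n) (ωgh n) ((n : ℝ) ^ 8) N μ ν b τ w)| ≤ CR τ)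
    (hU : ∀ n : ℕ, 2 ≤ n → ∀ u, |Ru u n| ≤ CU u) :
    D1Drift Lc Js N μ ν :=
  d1Drift_BFx_total_shell_of_prop12S Js hμν hN hL hodd ha c hD₂ hA₂ hδ₂ h12 h126 h2s d2s hB1 hK s hωs hlam hδW hE hJ hΛ hR hQ hEc hJc hΛc hRc hQc
    hEs hJs hΛs hRs hQs hdiv hrowgh
    (hRestTot_of_hRestS ha hμν (hGa_of_prop12 ha h12 h126) hδW hE hJ hΛ hR hQ s hRest) hU

end Summit.QuantumFields.BalabanUV.Beta.D1BFx.RoadEndBFxTotalShellS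

end
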